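import Summits.BirchSwinnertonDyer.BirchSwinnertonDyer.Theorems.GenusKolyvaginAtTwoGenusPrimitiveSupplyAtTwoHeegnerTwinParity
import Literature.NumberTheory.EllipticCurves.BoxerDiao2010.TamagawaTwistLocalProofs
import Literature.NumberTheory.EllipticCurves.QuadraticTwistPadicReduction
import Literature.NumberTheory.EllipticCurves.PastenValuationProductThm115Proofs
import Literature.NumberTheory.EllipticCurves.TamagawaNeZeroProofs
import Literature.NumberTheory.EllipticCurves.TamagawaVariableChangeProofs
import Literature.NumberTheory.EllipticCurves.GlobalMinimalModelProofs
import Mathlib.NumberTheory.Padics.RingHoms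
import HarnessLib

/-!
# Route `GenusKolyvaginAtTwo`, crux `GenusPrimitiveSupplyAtTwo` (stmt-BirchSwinnertonDyer-22136):
# Heegner twins of a `Δ < 0` curve have EVEN Tamagawa product

Seat `bsd-line-gk2-p5` g2 (cell `bsd-f1-sign2`), SUPPLY lineage; companion of
`…GenusPrimitiveSupplyAtTwoHeegnerTwinParity.lean` (reciprocity `(Δ_min | |d_K|) = sign Δ_min`, transposition primes).
Summit-side THEOREM-ONLY file (no definition, no named fact, no `sorry`), `--supports stmt-BirchSwinnertonDyer-22136`.

WHAT. For `W/ℚ` globally minimal (integral model `(aᵢ)`, `b`-invariants `bᵢ`, minimal discriminant `Δ_min`):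
* §4 `exists_zmod_root_twoTorsion_of_jacobiSym_eq_neg_one` — at a prime `q ≠ 2` with `(Δ_min / q) = −1` the
  `2`-division cubic `ψ = 4x³ + b₂x² + 2b₄x + b₆` has a SIMPLE root mod `q` (`disc ψ = 16Δ_min` is a non-square;
  finite-field lemma of the companion file).
* §5 `two_dvd_localTamagawaNumber_twist_of_root` — for `d = q·d₁` with `q ∤ 2d₁Δ_min` and a simple root of `ψ` mod `q`,
  EVERY `ℚ`-model `Wd ≅ W^{(d)}` has `2 ∣ c_q(Wd)`: the integer twist model `J = (0, d b₂, 0, 8d²b₄, 16d³b₆) ≅ W^{(d)}`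
  (`map_twistIntModel_eq_smul_quadraticTwist`) is `ℤ_q`-minimal in Tate's Step-6 shape with `Δ(J) = 2¹²d⁶Δ_min`
  (`Δ_twistIntModel`, `twistIntModel_padic_shape`), its Step-6 cubic is `ψ` rescaled (`exists_cubic_root_of_zmod_root`),
  the DVR lemma `LocalIndex.two_dvd_localTamagawaNumber_baseChange_of_cubic_simple_root` (`I₀*`, `c = 1 + #roots`) applies,
  and `c_q` is an isomorphism invariant (`localTamagawaNumber_variableChange_holds`).
* §6 `even_tamagawaProduct_twin_of_Δ_neg` — **`Δ_W < 0`, `K` imaginary quadratic with odd `d_K` and the Heegner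
  hypothesis for `N_W`, `Wd` any model of `W^{(d_K)}` ⇒ `Even Wd.tamagawaProduct`** (a transposition prime `q ∣ d_K`
  exists by the companion file; `q ∥ d_K` by `Quadratic.not_sq_dvd_discr_of_prime_ne_two`; `c_q ∣ ∏ c_v` by
  `tamagawaProduct_eq_prod`). Corollary `Δ_pos_of_odd_tamagawaProduct_twin`: an odd-Tamagawa such twin forces `Δ_W > 0`.

WHY (planner-facing). The route's glue consumes a rank-one input for the supplied twin `E^{(d_K)}`: crux #6
`MinimalTwinBSDTwo` (stmt-22985), or — on twins with ODD Tamagawa product — item 23715 `RankOneAtTwoBigImageOddLocal` via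
gk2-p4's bridge `MinimalTwinBSDTwo.bsdp_two_heegnerTwin_of_rankOneAtTwoBigImageOddLocal`
(`Theorems/GenusKolyvaginAtTwoMinimalTwinBSDTwoBridges.lean`; census TWIN-TAM-W52D: 100/591 first-found minimal twins are
odd-Tamagawa). This file PROVES that the odd-Tamagawa option is EMPTY on the `Δ_E < 0` part of the habitat (every
Kolyvagin-(H2) Heegner field has odd `d_K`): there the glue's rank-one input is crux #6 proper (or the residual), for every
choice of `K`. On `Δ_E > 0` the number of transposition primes is even (companion file), so «DEF(E,K) = 1» means every
prime of `d_K` is silent (`c_q = 1`), i.e. an odd-Tamagawa twin — the 23715 slice. Nothing here is conditional; no item is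
closed by this file; BSD is not proved by any of this.

References: [SilvermanAEC2009] III.1, VII.1 Prop. 1.3(b), VII.6 Ex. 7.6, VIII.8; [SilvermanATAEC1994] IV.9.4 Step 6;
[BoxerDiao2010] proof of Prop. 4.1 (p. 1977: "`c_p` is equal to `1` plus the number of roots … mod `p`").
-/
set_option linter.dupNamespace false -- tree convention: `Summit.BirchSwinnertonDyer.BirchSwinnertonDyer.Theorems` (summit = sub-problem)
set_option autoImplicit false

noncomputable section

open scoped Classical

open IsLocalRing NumberField WeierstrassCurve Literature.NumberTheory.EllipticCurves

namespace Summit.BirchSwinnertonDyer.BirchSwinnertonDyer.Theorems.GenusKolyTwin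
/-! ## §5. The local Tamagawa number of a quadratic twist at an odd prime `q ∥ d` of good reduction -/

section Local

/-- An integer prime to `q` is a unit of `ℤ_q`. [folklore] -/
theorem isUnit_intCast_padicInt_of_not_dvd (q : ℕ) [Fact q.Prime] {z : ℤ} (h : ¬ (q : ℤ) ∣ z) :
    IsUnit (z : ℤ_[q]) := by
  rw [PadicInt.isUnit_iff]
  exact le_antisymm (PadicInt.norm_le_one _)
    (not_lt.mp fun hlt => h ((PadicInt.norm_int_lt_one_iff_dvd z).mp hlt))

/-- `ℤ_q` is Henselian (it is `q`-adically complete). [folklore] -/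
theorem henselianLocalRing_padicInt (q : ℕ) [Fact q.Prime] : HenselianLocalRing ℤ_[q] :=
  { is_henselian := fun f hf a₀ h₁ h₂ =>
      HenselianRing.is_henselian (I := IsLocalRing.maximalIdeal ℤ_[q]) f hf a₀ h₁ (h₂.map _) }

/-- An integer prime to `q` is non-zero in the residue field of `ℤ_q`. [folklore] -/
theorem intCast_residueField_ne_zero (q : ℕ) [Fact q.Prime] {z : ℤ} (h : ¬ (q : ℤ) ∣ z) :
    (z : ResidueField ℤ_[q]) ≠ 0 := by
  rw [← map_intCast (residue ℤ_[q]), residue_ne_zero_iff_isUnit]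
  exact isUnit_intCast_padicInt_of_not_dvd q h

/-- Equal up to a change of variables ⇒ equal local Tamagawa numbers (Silverman *AEC* VII.6 Ex. 7.6; tree
`localTamagawaNumber_variableChange_holds`). [cite: SilvermanAEC2009, VII.6 Ex. 7.6] -/
theorem localTamagawaNumber_eq_of_eq_smul (q : ℕ) [Fact q.Prime] {X Y : WeierstrassCurve ℚ_[q]} [X.IsElliptic]
    [Y.IsElliptic] (C : VariableChange ℚ_[q]) (h : X = C • Y) :
    X.localTamagawaNumber ℤ_[q] = Y.localTamagawaNumber ℤ_[q] := by
  subst h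
  exact localTamagawaNumber_variableChange_holds ℤ_[q] Y C

/-- **The integer twist model.** For `W/ℚ` globally minimal with integral model `(aᵢ)`, `bᵢ` its `b`-invariants, and
`d ∈ ℤ`, the integer equation `J = (0, d b₂, 0, 8 d² b₄, 16 d³ b₆)` is `ℚ`-isomorphic to the tree's quadratic twist
`W^{(d)} = (0, d b₂/4, 0, d² b₄/2, d³ b₆/4)`: `J = C • W^{(d)}` with `C = (u = ½, 0, 0, 0)` (rescaling `aᵢ ↦ 2^i aᵢ`).
[cite: SilvermanAEC2009, III.1 Table 3.1] -/
theorem map_twistIntModel_eq_smul_quadraticTwist (W : WeierstrassCurve ℚ) [W.IsGloballyMinimal] (d : ℤ)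
    (Jz : WeierstrassCurve ℤ)
    (hJ : Jz = ⟨0, d * (integralModelInt W).b₂, 0, 8 * d ^ 2 * (integralModelInt W).b₄,
      16 * d ^ 3 * (integralModelInt W).b₆⟩) :
    Jz.map (Int.castRingHom ℚ) =
      (⟨Units.mk0 (2 : ℚ)⁻¹ (by norm_num), 0, 0, 0⟩ : VariableChange ℚ) • W.quadraticTwist (d : ℚ) := by
  have hb₂ : W.b₂ = ((integralModelInt W).b₂ : ℚ) := by
    conv_lhs => rw [← map_integralModelInt W]
    rw [map_b₂, eq_intCast]
  have hb₄ : W.b₄ = ((integralModelInt W).b₄ : ℚ) := by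
    conv_lhs => rw [← map_integralModelInt W]
    rw [map_b₄, eq_intCast]
  have hb₆ : W.b₆ = ((integralModelInt W).b₆ : ℚ) := by
    conv_lhs => rw [← map_integralModelInt W]
    rw [map_b₆, eq_intCast]
  subst hJ
  ext
  · simp [variableChange_a₁, quadraticTwist_a₁]
  · simp only [map_a₂, eq_intCast, Int.cast_mul, variableChange_a₂, quadraticTwist_a₁, quadraticTwist_a₂,
      Units.val_inv_eq_inv_val, Units.val_mk0, inv_inv, hb₂]
    ring
  · simp [variableChange_a₃, quadraticTwist_a₃, quadraticTwist_a₁]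
  · simp only [map_a₄, eq_intCast, Int.cast_mul, Int.cast_pow, Int.cast_ofNat, variableChange_a₄, quadraticTwist_a₁,
      quadraticTwist_a₂, quadraticTwist_a₃, quadraticTwist_a₄, Units.val_inv_eq_inv_val, Units.val_mk0, inv_inv, hb₄]
    ring
  · simp only [map_a₆, eq_intCast, Int.cast_mul, Int.cast_pow, Int.cast_ofNat, variableChange_a₆, quadraticTwist_a₁,
      quadraticTwist_a₂, quadraticTwist_a₃, quadraticTwist_a₄, quadraticTwist_a₆, Units.val_inv_eq_inv_val,
      Units.val_mk0, inv_inv, hb₆]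
    ring

/-- `Δ(J) = 2¹² d⁶ Δ_min(W)`. [cite: SilvermanAEC2009, III.1 Table 3.1] -/
theorem Δ_twistIntModel (W : WeierstrassCurve ℚ) [W.IsGloballyMinimal] (d : ℤ) (Jz : WeierstrassCurve ℤ)
    (hJ : Jz = ⟨0, d * (integralModelInt W).b₂, 0, 8 * d ^ 2 * (integralModelInt W).b₄,
      16 * d ^ 3 * (integralModelInt W).b₆⟩) :
    Jz.Δ = 2 ^ 12 * d ^ 6 * minimalDiscriminantInt W := by
  subst hJ
  simp only [minimalDiscriminantInt, WeierstrassCurve.Δ, WeierstrassCurve.b₂, WeierstrassCurve.b₄,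
    WeierstrassCurve.b₆, WeierstrassCurve.b₈]
  ring

/-- At `q ∣ d`, `d = q d₁`, the integer twist model read in `ℤ_q` has Tate's Step-6 shape `a₁ = q·0`, `a₂ = q·(d₁b₂)`,
`a₃ = q²·0`, `a₄ = q²·(8d₁²b₄)`, `a₆ = q³·(16d₁³b₆)`. [cite: SilvermanATAEC1994, IV.9.4 Step 6 (PDF p. 345)] -/
theorem twistIntModel_padic_shape (q : ℕ) [Fact q.Prime] (W : WeierstrassCurve ℚ) [W.IsGloballyMinimal] {d d₁ : ℤ}
    (hd : d = q * d₁) (Jz : WeierstrassCurve ℤ)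
    (hJ : Jz = ⟨0, d * (integralModelInt W).b₂, 0, 8 * d ^ 2 * (integralModelInt W).b₄,
      16 * d ^ 3 * (integralModelInt W).b₆⟩) :
    (Jz.map (Int.castRingHom ℤ_[q])).a₁ = (q : ℤ_[q]) * 0 ∧
      (Jz.map (Int.castRingHom ℤ_[q])).a₂ = (q : ℤ_[q]) * ((d₁ : ℤ_[q]) * ((integralModelInt W).b₂ : ℤ_[q])) ∧
      (Jz.map (Int.castRingHom ℤ_[q])).a₃ = (q : ℤ_[q]) ^ 2 * 0 ∧
      (Jz.map (Int.castRingHom ℤ_[q])).a₄ =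
        (q : ℤ_[q]) ^ 2 * (8 * (d₁ : ℤ_[q]) ^ 2 * ((integralModelInt W).b₄ : ℤ_[q])) ∧
      (Jz.map (Int.castRingHom ℤ_[q])).a₆ =
        (q : ℤ_[q]) ^ 3 * (16 * (d₁ : ℤ_[q]) ^ 3 * ((integralModelInt W).b₆ : ℤ_[q])) := by
  subst hJ
  simp only [WeierstrassCurve.map_a₁, WeierstrassCurve.map_a₂, WeierstrassCurve.map_a₃,
    WeierstrassCurve.map_a₄, WeierstrassCurve.map_a₆, hd, eq_intCast, Int.cast_zero, Int.cast_mul,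
    Int.cast_pow, Int.cast_ofNat, Int.cast_natCast]
  refine ⟨by ring, by ring, by ring, by ring, by ring⟩

/-- A root `x₀ ∈ 𝔽_q` of the `2`-division cubic `ψ(x) = 4x³ + b₂x² + 2b₄x + b₆` of the minimal model with `ψ'(x₀) ≠ 0`
gives the simple root `t = 4d̄₁x₀` of the Step-6 cubic `T³ + d̄₁b̄₂T² + 8d̄₁²b̄₄T + 16d̄₁³b̄₆` in the residue field of `ℤ_q`
(`P(4d₁x) = 16d₁³ψ(x)`, `P'(4d₁x) = 4d₁²ψ'(x)`). [folklore] -/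
theorem exists_cubic_root_of_zmod_root (q : ℕ) [hq : Fact q.Prime] (W : WeierstrassCurve ℚ) [W.IsGloballyMinimal]
    (hq2 : q ≠ 2) {d₁ : ℤ} (hd₁ : ¬ (q : ℤ) ∣ d₁) {x₀ : ZMod q}
    (hx₀ : 4 * x₀ ^ 3 + ((integralModelInt W).b₂ : ZMod q) * x₀ ^ 2 + 2 * ((integralModelInt W).b₄ : ZMod q) * x₀ +
      ((integralModelInt W).b₆ : ZMod q) = 0)
    (hx₀' : 12 * x₀ ^ 2 + 2 * ((integralModelInt W).b₂ : ZMod q) * x₀ + 2 * ((integralModelInt W).b₄ : ZMod q) ≠ 0) :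
    ∃ t : ResidueField ℤ_[q],
      t ^ 3 + residue ℤ_[q] ((d₁ : ℤ_[q]) * ((integralModelInt W).b₂ : ℤ_[q])) * t ^ 2 +
          residue ℤ_[q] (8 * (d₁ : ℤ_[q]) ^ 2 * ((integralModelInt W).b₄ : ℤ_[q])) * t +
          residue ℤ_[q] (16 * (d₁ : ℤ_[q]) ^ 3 * ((integralModelInt W).b₆ : ℤ_[q])) = 0 ∧
        3 * t ^ 2 + 2 * residue ℤ_[q] ((d₁ : ℤ_[q]) * ((integralModelInt W).b₂ : ℤ_[q])) * t +
          residue ℤ_[q] (8 * (d₁ : ℤ_[q]) ^ 2 * ((integralModelInt W).b₄ : ℤ_[q])) ≠ 0 := by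
  set k := ResidueField ℤ_[q]
  set e : k ≃+* ZMod q := PadicInt.residueField (p := q) with he
  set x : k := e.symm x₀ with hx
  have hex : e x = x₀ := by rw [hx, RingEquiv.apply_symm_apply]
  have hxk : 4 * x ^ 3 + ((integralModelInt W).b₂ : k) * x ^ 2 + 2 * ((integralModelInt W).b₄ : k) * x +
      ((integralModelInt W).b₆ : k) = 0 := by
    apply e.injective
    simp only [map_add, map_mul, map_pow, map_ofNat, map_intCast, hex, hx₀, map_zero]
  have hxk' : 12 * x ^ 2 + 2 * ((integralModelInt W).b₂ : k) * x + 2 * ((integralModelInt W).b₄ : k) ≠ 0 := by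
    intro h0
    apply hx₀'
    have := congr_arg e h0
    simpa only [map_add, map_mul, map_pow, map_ofNat, map_intCast, hex, map_zero] using this
  have hdk : ((d₁ : ℤ) : k) ≠ 0 := intCast_residueField_ne_zero q hd₁
  have h2k : ((2 : ℤ) : k) ≠ 0 := by
    refine intCast_residueField_ne_zero q fun h => hq2 ?_
    exact ((Nat.prime_dvd_prime_iff_eq hq.out Nat.prime_two).mp (by exact_mod_cast h))
  push_cast at h2k
  refine ⟨4 * (d₁ : k) * x, ?_, ?_⟩
  · simp only [map_mul, map_pow, map_ofNat, map_intCast]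
    linear_combination (16 * (d₁ : k) ^ 3) * hxk
  · simp only [map_mul, map_pow, map_ofNat, map_intCast]
    intro h0
    apply hxk'
    have h16 : (4 * (d₁ : k) ^ 2) ≠ 0 := by
      have : (4 : k) = 2 * 2 := by norm_num
      rw [this]
      exact mul_ne_zero (mul_ne_zero h2k h2k) (pow_ne_zero _ hdk)
    have : 4 * (d₁ : k) ^ 2 *
        (12 * x ^ 2 + 2 * ((integralModelInt W).b₂ : k) * x + 2 * ((integralModelInt W).b₄ : k)) = 0 := by
      linear_combination h0
    exact (mul_eq_zero.mp this).resolve_left h16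

/-- **`q ∥ d`, `q ∤ 2Δ_min(W)`, a simple root of the `2`-division cubic mod `q` ⇒ `2 ∣ c_q(E^{(d)})`, for ANY
`ℚ`-model `Wd` of the twist** (Kodaira type `I₀*` with a rational `2`-torsion root: Boxer–Diao 2010, proof of Prop. 4.1,
"`c_p` is equal to `1` plus the number of roots of the `2`-division polynomial mod `p`"; here for an arbitrary curve via
its minimal model). The integer twist model `J = (0, d b₂, 0, 8d²b₄, 16d³b₆)` is `ℤ_q`-minimal of Step-6 shape
(`Δ(J) = q⁶·unit`), the DVR lemma `LocalIndex.two_dvd_localTamagawaNumber_baseChange_of_cubic_simple_root` gives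
`2 ∣ c_q(J)`, and `c_q` is an isomorphism invariant (`localTamagawaNumber_variableChange_holds`).
[cite: BoxerDiao2010, proof of Prop. 4.1 (p. 1977)] [cite: SilvermanATAEC1994, IV.9.4 Step 6 (PDF p. 345)] -/
theorem two_dvd_localTamagawaNumber_twist_of_root (q : ℕ) [hq : Fact q.Prime] (hq2 : q ≠ 2) (W : WeierstrassCurve ℚ)
    [W.IsGloballyMinimal] {d d₁ : ℤ} (hd : d = q * d₁) (hd₁ : ¬ (q : ℤ) ∣ d₁)
    (hqΔ : ¬ (q : ℤ) ∣ minimalDiscriminantInt W) {x₀ : ZMod q}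
    (hx₀ : 4 * x₀ ^ 3 + ((integralModelInt W).b₂ : ZMod q) * x₀ ^ 2 + 2 * ((integralModelInt W).b₄ : ZMod q) * x₀ +
      ((integralModelInt W).b₆ : ZMod q) = 0)
    (hx₀' : 12 * x₀ ^ 2 + 2 * ((integralModelInt W).b₂ : ZMod q) * x₀ + 2 * ((integralModelInt W).b₄ : ZMod q) ≠ 0)
    {Wd : WeierstrassCurve ℚ} [Wd.IsElliptic] (Cd : VariableChange ℚ)
    (hWd : Cd • W.quadraticTwist (d : ℚ) = Wd) :
    2 ∣ (Wd.baseChange ℚ_[q]).localTamagawaNumber ℤ_[q] := by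
  haveI := henselianLocalRing_padicInt q
  have hq' : Prime (q : ℤ) := Nat.prime_iff_prime_int.mp hq.out
  have h2 : ¬ (q : ℤ) ∣ 2 := fun h => by
    have : q ∣ 2 := by exact_mod_cast h
    exact hq2 ((Nat.prime_dvd_prime_iff_eq hq.out Nat.prime_two).mp this)
  set Jz : WeierstrassCurve ℤ := ⟨0, d * (integralModelInt W).b₂, 0, 8 * d ^ 2 * (integralModelInt W).b₄,
    16 * d ^ 3 * (integralModelInt W).b₆⟩ with hJ
  set N : WeierstrassCurve ℤ_[q] := Jz.map (Int.castRingHom ℤ_[q]) with hN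
  obtain ⟨s1, s2, s3, s4, s6⟩ := twistIntModel_padic_shape q W hd Jz hJ
  -- `Δ(N) = q⁶ · unit`
  have hu : IsUnit (((2 ^ 12 * d₁ ^ 6 * minimalDiscriminantInt W : ℤ)) : ℤ_[q]) := by
    refine isUnit_intCast_padicInt_of_not_dvd q (z := 2 ^ 12 * d₁ ^ 6 * minimalDiscriminantInt W) fun h => ?_
    rcases hq'.dvd_or_dvd h with h | h
    · rcases hq'.dvd_or_dvd h with h | h
      · exact h2 (hq'.dvd_of_dvd_pow h)
      · exact hd₁ (hq'.dvd_of_dvd_pow h)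
    · exact hqΔ h
  have hΔeq : N.Δ = (q : ℤ_[q]) ^ 6 * (((2 ^ 12 * d₁ ^ 6 * minimalDiscriminantInt W : ℤ)) : ℤ_[q]) := by
    rw [hN, WeierstrassCurve.map_Δ, Δ_twistIntModel W d Jz hJ, hd, eq_intCast]
    push_cast
    ring
  haveI : WeierstrassCurve.IsIntegral ℤ_[q] (N.baseChange ℚ_[q]) := ⟨⟨_, rfl⟩⟩
  have hval : (IsDiscreteValuationRing.maximalIdeal ℤ_[q]).valuation ℚ_[q] (N.baseChange ℚ_[q]).Δ =
      WithZero.exp (-(6 : ℕ) : ℤ) := by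
    rw [WeierstrassCurve.baseChange, WeierstrassCurve.map_Δ, hΔeq]
    exact LocalIndex.valuation_algebraMap_pow_mul_of_isUnit PadicInt.irreducible_p hu 6
  haveI : (N.baseChange ℚ_[q]).IsMinimal ℤ_[q] :=
    WeierstrassCurve.isMinimal_of_exp_lt_valuation_Δ _ (by rw [hval, WithZero.exp_lt_exp]; norm_num)
  have hΔK : (N.baseChange ℚ_[q]).Δ ≠ 0 := by
    rw [WeierstrassCurve.baseChange, WeierstrassCurve.map_Δ, hΔeq]
    exact (map_ne_zero_iff _ (IsFractionRing.injective ℤ_[q] ℚ_[q])).mpr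
      (mul_ne_zero (pow_ne_zero _ PadicInt.irreducible_p.ne_zero) hu.ne_zero)
  haveI : (N.baseChange ℚ_[q]).IsElliptic := (WeierstrassCurve.isElliptic_iff _).mpr (Ne.isUnit hΔK)
  -- `2 ∣ c_q(N)`
  obtain ⟨t, ht, ht'⟩ := exists_cubic_root_of_zmod_root q W hq2 hd₁ hx₀ hx₀'
  have h2N : 2 ∣ (N.baseChange ℚ_[q]).localTamagawaNumber ℤ_[q] :=
    LocalIndex.two_dvd_localTamagawaNumber_baseChange_of_cubic_simple_root _
      PadicInt.irreducible_p s1 s2 s3 s4 s6 ht ht'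
  -- `Wd ⊗ ℚ_q ≅ N ⊗ ℚ_q`
  set C₂ : VariableChange ℚ := ⟨Units.mk0 (2 : ℚ)⁻¹ (by norm_num), 0, 0, 0⟩ with hC₂
  have hJQ : Jz.map (Int.castRingHom ℚ) = C₂ • W.quadraticTwist (d : ℚ) :=
    map_twistIntModel_eq_smul_quadraticTwist W d Jz hJ
  have hNK : N.baseChange ℚ_[q] = (Jz.map (Int.castRingHom ℚ)).baseChange ℚ_[q] := by
    rw [hN, WeierstrassCurve.baseChange, WeierstrassCurve.baseChange, WeierstrassCurve.map_map,
      WeierstrassCurve.map_map, RingHom.ext_int ((algebraMap ℚ ℚ_[q]).comp (Int.castRingHom ℚ))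
        ((algebraMap ℤ_[q] ℚ_[q]).comp (Int.castRingHom ℤ_[q]))]
  haveI : (Wd.baseChange ℚ_[q]).IsElliptic := inferInstanceAs (Wd.map (algebraMap ℚ ℚ_[q])).IsElliptic
  have hWdK : Wd.baseChange ℚ_[q] =
      (Cd.baseChange ℚ_[q] * (C₂.baseChange ℚ_[q])⁻¹) • N.baseChange ℚ_[q] := by
    rw [hNK, hJQ, WeierstrassCurve.baseChange_smul_eq, mul_smul, inv_smul_smul,
      ← WeierstrassCurve.baseChange_smul_eq, hWd]
  rw [localTamagawaNumber_eq_of_eq_smul q _ hWdK]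
  exact h2N

end Local

/-! ## §4. The `2`-division cubic of `W` has a simple root mod every transposition prime -/

section TwoDivision

open Polynomial

/-- In a field, `¬ IsSquare u ⇒ ¬ IsSquare (16·u)`. [folklore] -/
theorem not_isSquare_sixteen_mul {F : Type*} [Field F] {u : F} (hu : ¬ IsSquare u) (h2 : (2 : F) ≠ 0) :
    ¬ IsSquare (16 * u) := by
  rintro ⟨r, hr⟩
  apply hu
  have h4 : (4 : F) ≠ 0 := by
    have : (4 : F) = 2 * 2 := by norm_num
    rw [this]; exact mul_ne_zero h2 h2
  refine ⟨r * 4⁻¹, ?_⟩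
  field_simp
  linear_combination hr

/-- **At a prime `q ∤ 2Δ_min(W)` with `(Δ_min(W) / q) = −1` the `2`-division cubic
`ψ(x) = 4x³ + b₂x² + 2b₄x + b₆` of the minimal model has a SIMPLE root mod `q`** (its discriminant is `16·Δ_min`,
Silverman *AEC* III.1, a non-square mod `q`; `exists_isRoot_of_not_isSquare_discr`, `eval_derivative_ne_zero_of_discr_ne_zero`).
The root is an `𝔽_q`-rational point of order `2` on the reduction: `q` is a «transposition prime» for `W`.
[cite: SilvermanAEC2009, III.1 (ψ₂, Δ)] -/
theorem exists_zmod_root_twoTorsion_of_jacobiSym_eq_neg_one (W : WeierstrassCurve ℚ) [W.IsGloballyMinimal]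
    {q : ℕ} [Fact q.Prime] (hq2 : q ≠ 2) (hJ : jacobiSym (minimalDiscriminantInt W) q = -1) :
    ∃ x : ZMod q,
      4 * x ^ 3 + ((integralModelInt W).b₂ : ZMod q) * x ^ 2 + 2 * ((integralModelInt W).b₄ : ZMod q) * x +
          ((integralModelInt W).b₆ : ZMod q) = 0 ∧
        12 * x ^ 2 + 2 * ((integralModelInt W).b₂ : ZMod q) * x + 2 * ((integralModelInt W).b₄ : ZMod q) ≠ 0 := by
  have hq : q.Prime := Fact.out
  set M : WeierstrassCurve (ZMod q) := (integralModelInt W).map (Int.castRingHom (ZMod q)) with hM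
  have hchar : ringChar (ZMod q) ≠ 2 := by rw [ZMod.ringChar_zmod_n]; exact hq2
  have h2 : (2 : ZMod q) ≠ 0 := by
    have : ((2 : ℕ) : ZMod q) ≠ 0 := by
      rw [Ne, ZMod.natCast_eq_zero_iff]
      intro h
      exact hq2 ((Nat.prime_dvd_prime_iff_eq hq Nat.prime_two).mp h)
    exact_mod_cast this
  have hnsq : ¬ IsSquare ((minimalDiscriminantInt W : ℤ) : ZMod q) := ZMod.nonsquare_of_jacobiSym_eq_neg_one hJ
  have hΔM : M.Δ = ((minimalDiscriminantInt W : ℤ) : ZMod q) := by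
    rw [hM, WeierstrassCurve.map_Δ, minimalDiscriminantInt, eq_intCast]
  have hdisc : ¬ IsSquare M.twoTorsionPolynomial.discr := by
    rw [WeierstrassCurve.twoTorsionPolynomial_discr, hΔM]
    exact not_isSquare_sixteen_mul hnsq h2
  have hdisc0 : M.twoTorsionPolynomial.discr ≠ 0 := fun h => hdisc (h ▸ ⟨0, (mul_zero 0).symm⟩)
  have ha : M.twoTorsionPolynomial.a ≠ 0 := by
    show (4 : ZMod q) ≠ 0
    have : (4 : ZMod q) = 2 * 2 := by norm_num
    rw [this]; exact mul_ne_zero h2 h2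
  obtain ⟨x, hx⟩ := exists_isRoot_of_not_isSquare_discr hchar M.twoTorsionPolynomial ha hdisc
  have hx' := eval_derivative_ne_zero_of_discr_ne_zero M.twoTorsionPolynomial ha hdisc0 hx
  have hb₂ : M.b₂ = ((integralModelInt W).b₂ : ZMod q) := by rw [hM, WeierstrassCurve.map_b₂, eq_intCast]
  have hb₄ : M.b₄ = ((integralModelInt W).b₄ : ZMod q) := by rw [hM, WeierstrassCurve.map_b₄, eq_intCast]
  have hb₆ : M.b₆ = ((integralModelInt W).b₆ : ZMod q) := by rw [hM, WeierstrassCurve.map_b₆, eq_intCast]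
  refine ⟨x, ?_, ?_⟩
  · have h := hx.eq_zero
    simp only [WeierstrassCurve.twoTorsionPolynomial, Cubic.toPoly, eval_add, eval_mul, eval_C, eval_pow, eval_X,
      hb₂, hb₄, hb₆] at h
    linear_combination h
  · intro h0
    apply hx'
    simp only [WeierstrassCurve.twoTorsionPolynomial, Cubic.toPoly, derivative_add, derivative_mul, derivative_C,
      derivative_X_pow, derivative_X, eval_add, eval_mul, eval_C, eval_pow, eval_X, zero_mul,
      add_zero, zero_add, mul_one, hb₂, hb₄, hb₆]
    push_cast
    linear_combination h0

end TwoDivision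

/-! ## §6. Global: `Δ_W < 0` ⇒ every odd-`d_K` Heegner twin has EVEN Tamagawa product -/

section Global

open Rat.HeightOneSpectrum

/-- **Heegner twins of a `Δ < 0` curve have even Tamagawa product.** `W/ℚ` globally minimal with `Δ_W < 0`, `K`
imaginary quadratic with ODD discriminant satisfying the Heegner hypothesis for the conductor of `W`, `Wd` ANY `ℚ`-model of
the twist `W^{(d_K)}`: then `2 ∣ ∏_v c_v(Wd)`. Proof: by `exists_prime_dvd_discr_jacobiSym_eq_neg_one_of_Δ_neg` some
prime `q ∣ d_K` (odd, `q ∤ N`, so `q ∥ d_K` by `not_sq_dvd_discr_of_prime_ne_two` and `q ∤ Δ_min`) has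
`(Δ_min / q) = −1`; the `2`-division cubic then has a simple root mod `q`
(`exists_zmod_root_twoTorsion_of_jacobiSym_eq_neg_one`), so `2 ∣ c_q(Wd)` (`two_dvd_localTamagawaNumber_twist_of_root`,
type `I₀*`), and `c_q` divides the Tamagawa product (`tamagawaProduct_eq_prod`). In the cell's language: for `Δ_E < 0`
the number of «transposition primes» of `d_K` is odd, hence `≥ 1`, and each contributes `c_q = 2`.
[cite: SilvermanATAEC1994, IV.9.4 Step 6 (PDF p. 345)] [cite: BoxerDiao2010, proof of Prop. 4.1 (p. 1977)] -/
theorem even_tamagawaProduct_twin_of_Δ_neg (W : WeierstrassCurve ℚ) [W.IsElliptic] [W.IsGloballyMinimal]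
    (hΔ : W.Δ < 0) {K : Type} [Field K] [NumberField K] (hK : IsImaginaryQuadratic K) (hodd : Odd (discr K))
    (hH : SatisfiesHeegnerHypothesis (W.conductorNorm ℤ) K) {Wd : WeierstrassCurve ℚ} [Wd.IsElliptic]
    (Cd : VariableChange ℚ) (hWd : Cd • W.quadraticTwist (discr K : ℚ) = Wd) : Even Wd.tamagawaProduct := by
  obtain ⟨q, hq, hq2, hqd, -, hqΔ, hJ⟩ := exists_prime_dvd_discr_jacobiSym_eq_neg_one_of_Δ_neg W hK hodd hH hΔ
  haveI := Fact.mk hq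
  obtain ⟨d₁, hd⟩ := hqd
  have hd₁ : ¬ (q : ℤ) ∣ d₁ := by
    rintro ⟨e, rfl⟩
    exact Literature.NumberTheory.QuadraticFields.Quadratic.not_sq_dvd_discr_of_prime_ne_two hK.1 hq hq2
      ⟨e, by rw [hd]; ring⟩
  obtain ⟨x₀, hx₀, hx₀'⟩ := exists_zmod_root_twoTorsion_of_jacobiSym_eq_neg_one W hq2 hJ
  have h2c : 2 ∣ (Wd.baseChange ℚ_[q]).localTamagawaNumber ℤ_[q] :=
    two_dvd_localTamagawaNumber_twist_of_root q hq2 W hd hd₁ hqΔ hx₀ hx₀' Cd hWd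
  -- `c_q ∣ ∏_v c_v`
  have hfWd : (Wd.badPlaces ℤ).Finite := Wd.finite_badPlaces_holds ℤ
  set v : IsDedekindDomain.HeightOneSpectrum ℤ := primesEquiv.symm ⟨q, hq⟩ with hv
  set s : Finset (IsDedekindDomain.HeightOneSpectrum ℤ) := hfWd.toFinset ∪ {v} with hs
  have hsWd : ∀ w, ¬ Wd.HasGoodReductionAt w → w ∈ s := fun w hw ↦
    Finset.mem_union_left _ (by rw [Set.Finite.mem_toFinset, mem_badPlaces_iff]; exact hw)
  rw [even_iff_two_dvd, tamagawaProduct_eq_prod Wd s hsWd]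
  refine dvd_trans ?_ (Finset.dvd_prod_of_mem _ (Finset.mem_union_right _ (Finset.mem_singleton_self v)))
  have hpv : primesEquiv v = ⟨q, hq⟩ := by rw [hv, Equiv.apply_symm_apply]
  generalize primesEquiv v = P at hpv ⊢
  subst hpv
  exact h2c

/-- **Corollary (placement).** On the `Δ_W < 0` part of the habitat NO odd-`d_K` Heegner twin has odd Tamagawa product:
the odd-Tamagawa bridge `MinimalTwinBSDTwo ⟸ RankOneAtTwoBigImageOddLocal` (gk2-p4,
`Theorems/GenusKolyvaginAtTwoMinimalTwinBSDTwoBridges.lean`, `bsdp_two_heegnerTwin_of_rankOneAtTwoBigImageOddLocal`,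
hypothesis `Odd Wd.tamagawaProduct`) is vacuous there; equivalently an odd-Tamagawa Heegner twin forces `Δ_W > 0`.
[cite: SilvermanATAEC1994, IV.9.4 Step 6 (PDF p. 345)] -/
theorem Δ_pos_of_odd_tamagawaProduct_twin (W : WeierstrassCurve ℚ) [W.IsElliptic] [W.IsGloballyMinimal]
    {K : Type} [Field K] [NumberField K] (hK : IsImaginaryQuadratic K) (hodd : Odd (discr K))
    (hH : SatisfiesHeegnerHypothesis (W.conductorNorm ℤ) K) {Wd : WeierstrassCurve ℚ} [Wd.IsElliptic]
    (Cd : VariableChange ℚ) (hWd : Cd • W.quadraticTwist (discr K : ℚ) = Wd) (hT : Odd Wd.tamagawaProduct) :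
    0 < W.Δ := by
  rcases lt_trichotomy W.Δ 0 with h | h | h
  · exact absurd (even_tamagawaProduct_twin_of_Δ_neg W h hK hodd hH Cd hWd) (Nat.not_even_iff_odd.mpr hT)
  · exact absurd h W.Δ'.ne_zero
  · exact h

end Global

end Summit.BirchSwinnertonDyer.BirchSwinnertonDyer.Theorems.GenusKolyTwin

end
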